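import Summits.AtomisticToContinuum.HydrodynamicLimit.Theorems.TwoClocksClampedEntropyClockTimeZeroReference
import Summits.AtomisticToContinuum.HydrodynamicLimit.Theorems.TwoClocksClampedWindowDockTimeZero
import Literature.MathematicalPhysics.KineticTheory.HardSphereEulerLLN
import Literature.MathematicalPhysics.KineticTheory.HardSphereEulerProofs
import HarnessLib

/-!
# The multi-window summation of the entropy ledger, in band (stub `stub_ledgerFromWindows` of line `IdeatorOneSketch`,
crux `HydroLimitInBand`, stmt-AtomisticToContinuum-9133; skeleton v8)

Support file (`--supports stmt-AtomisticToContinuum-9133`). Registered stub (skeleton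
`Cruxes/HydroLimitInBand/Lines/IdeatorOneSketch.lean`, v8):
`stub_ledgerFromWindows : OneWindowLedgerInBand → WindowContinuityInBand → LedgerAprioriBound → LedgerIntegratedCoreInBand`;
the four line-local propositions are restated here byte-identically (same short names, this file's namespace), exactly as
the sibling crux 14680's helper `…ClampedCurrentsDockLedgerGlue.lean` does with `LedgerIntegralCore`.

Proof summary. Frame: `ηp := min ηp_W r` (the guard on `[0,T) ⊇ [0,t]` then gives the packing `ρ_s σ³ < r` needed by
the continuity and the a-priori bound), `σ₀ := min σ_W (min σ_C (min σ_z (1/2)))` with `σ_z` from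
`QuenchedCellClock.stub_timeZeroReference`, so that `H_N(0) = 0` (`EntropyClockDock.klDiv_lawAt_zero_localGibbsLaw`);
`K` is the one-window constant. Given `ε`, put `ε₁ := ε/(2(t+1))`, `ε₂ := ε/(2(Kt+1))`, take `τ, N₁` from the one-window
ledger at accuracy `ε₁` and `N₂` from the window continuity at scale `τ`, accuracy `ε₂`; `N₀ := max N₁ N₂`. For fixed
`N ≥ N₀` everything is real analysis on `s ↦ H_N(s)` (bounded on `[0,t]` by the a-priori bound, so the running suprema are
honest): `ledger_sum_of_windows` — on the grid `s_k = k w_N` below `t′` the window bounds telescope, continuity turns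
`sup_{[0,s_{k+1}]} H_N` into `sup_{[0,s_k]} H_N + (N+1)ε₂` and bounds the last partial window, the left Riemann sum of the
monotone running supremum is below its integral, and `(N+1)(ε₂ + tε₁ + Ktε₂) ≤ (N+1)ε`.
-/

noncomputable section

open MeasureTheory Filter Set Topology InformationTheory
open scoped ENNReal

namespace Summit.AtomisticToContinuum.HydrodynamicLimit.Theorems.HydroLimitInBandLedger

open Literature.MathematicalPhysics.KineticTheory Literature.Analysis.FluidPDE
open Literature.Analysis.FunctionSpaces

/-- **S7a (shared with the sibling, verbatim) = `LedgerAprioriBound`** — the a-priori entropy bound along the explicit reference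
family: for `Rf ∈ [1,2]` continuous on `[0,r]`, `0 < σ < 1/2`, a classical solution, `t ∈ (0,T)` with packing `ρ_s σ³ < r` on
`[0,t]`, every `N`, every flow, the relative entropies `KL(lawAt Φ λ_N s ‖ localGibbsLaw σ (ρ_s·Rf(σ³ρ_s)) (u s) (θ s))`,
`s ∈ [0,t]`, are bounded by one real `B`. Provable now (finite-`N` bookkeeping `toReal_klDiv_lawAt_eq_integral` + bounds uniform on
the compact `[0,t] × 𝕋³`); finiteness itself is `JaynesSqueezeClosure.klDiv_lawAt_localGibbsLaw_ne_top`. -/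
def LedgerAprioriBound : Prop :=
  ∀ (r : ℝ) (Rf : ℝ → ℝ), 0 < r → (∀ x ∈ Icc 0 r, 1 ≤ Rf x ∧ Rf x ≤ 2) → ContinuousOn Rf (Icc 0 r) →
    ∀ (a₀ θ₀ : T3 → ℝ) (u₀ : T3 → V3), Continuous a₀ → Continuous θ₀ → Continuous u₀ →
      (∀ x, 0 < a₀ x) → (∀ x, 0 < θ₀ x) →
      ∀ σ : ℝ, 0 < σ → σ < 1 / 2 →
        ∀ (T : ℝ) (ρ θ : ℝ → T3 → ℝ) (u : ℝ → T3 → V3), IsHardSphereEulerSolution σ T ρ u θ →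
          ∀ t ∈ Set.Ioo 0 T, (∀ s ∈ Set.Icc 0 t, ∀ x, ρ s x * σ ^ 3 < r) →
            ∀ (N : ℕ) (Φ : HardSphereFlow (Torus.geometry (Fin 3)) (hsDiameter σ N) (N + 1)),
              ∃ B : ℝ, ∀ s ∈ Set.Icc 0 t,
                klDiv (Φ.lawAt (localGibbsLaw σ a₀ u₀ θ₀ N Φ) s)
                  (localGibbsLaw σ (fun x => ρ s x * Rf (σ ^ 3 * ρ s x)) (u s) (θ s) N Φ) ≤ ENNReal.ofReal B

/-- **THE HEART'S TARGET = `LedgerIntegratedCoreInBand`** — the sibling's integrated ledger `LedgerIntegratedCore` (clause (ii)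
of `ClampedCurrentsDockLedgerGlue.LedgerIntegralCore`) with `HsEosLowDensity → DiluteSelfConsistency →` REPLACED by an in-band
packing threshold `∃ ηp > 0` and the guard `ρ_s(x)σ³ < ηp` on `[0,T) × 𝕋³`: for every insertion factor `Rf` (four defining
properties) and every `η₀` carrying the matrix of `UniformLocalGibbsConcentration`, `∃ ηp` such that for continuous positive
profiles `∃ σ₀ ∀ σ < σ₀`, for every classical solution IN THE BAND, every tied flow family and `t ∈ (0,T)`:
`∃ K ≥ 0 ∀ ε > 0 ∃ N₀ ∀ N ≥ N₀ ∀ t′ ∈ [0,t]: H_N(t′) ≤ (N+1)ε + K ∫₀^{t′} sup_{s ≤ r} H_N(s) dr`,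
`H_N(s) := KL(lawAt Φ_N λ_N s ‖ localGibbsLaw σ (ρ_s Rf(σ³ρ_s)) (u s) (θ s))`. v8: the frame also carries the power series
and the Lipschitz bound of `Rf` (both delivered by `stub_eosRatioAnalytic`; the time-regularity of the reference family needs
them), which only weakens the statement. -/
def LedgerIntegratedCoreInBand : Prop :=
  ∀ (r : ℝ) (Rf : ℝ → ℝ), 0 < r →
    (∃ p : FormalMultilinearSeries ℝ ℝ ℝ, HasFPowerSeriesOnBall Rf p 0 (ENNReal.ofReal r)) →
    (∃ L : NNReal, LipschitzOnWith L Rf (Icc 0 r)) →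
    (∀ x ∈ Ioo (-r) r, 0 < Rf x ∧ Rf x * (∑' j : ℕ, bE j / (j.factorial : ℝ) * (x * Rf x) ^ j) = 1) →
    (∀ x ∈ Icc 0 r, 1 ≤ Rf x ∧ Rf x ≤ 2) → ContinuousOn Rf (Icc 0 r) →
    (∀ x ∈ Ioo (-r) r, ∀ R ∈ Icc (1 / 2 : ℝ) 2,
      R * (∑' j : ℕ, bE j / (j.factorial : ℝ) * (x * R) ^ j) = 1 → R = Rf x) →
    ∀ η₀ : ℝ, 0 < η₀ →
    (∀ (a θ₀ : T3 → ℝ) (u₀ : T3 → V3), Continuous a → Continuous θ₀ → Continuous u₀ → (∀ x, 0 < a x) →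
      (∀ x, 0 < θ₀ x) → ∀ σ : ℝ, 0 < σ → σ ^ 3 * (⨆ x, a x) ≤ η₀ * ∫ x, a x →
      ∃ ρ₀ : T3 → ℝ, Continuous ρ₀ ∧ (∀ x, 0 < ρ₀ x) ∧
        (∀ (N : ℕ) (Φ : HardSphereFlow (Torus.geometry (Fin 3)) (hsDiameter σ N) (N + 1)),
          IsProbabilityMeasure (localGibbsLaw σ a u₀ θ₀ N Φ)) ∧
        ∀ χ : T3 → ℝ, Continuous χ → ∀ δ : ℝ, 0 < δ → ∃ C : ℝ, 0 < C ∧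
          ∀ (N : ℕ) (Φ : HardSphereFlow (Torus.geometry (Fin 3)) (hsDiameter σ N) (N + 1)),
            localGibbsLaw σ a u₀ θ₀ N Φ {z | δ < |empiricalDensityField z χ - ∫ x, χ x * ρ₀ x|} ≤
                ENNReal.ofReal (C * Real.exp (-(C⁻¹ * ((N : ℝ) + 1)))) ∧
              localGibbsLaw σ a u₀ θ₀ N Φ
                  {z | δ < ‖empiricalMomentumField z χ - ∫ x, (χ x * ρ₀ x) • u₀ x‖} ≤
                ENNReal.ofReal (C * Real.exp (-(C⁻¹ * ((N : ℝ) + 1)))) ∧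
              localGibbsLaw σ a u₀ θ₀ N Φ {z | δ < |empiricalEnergyField z χ -
                  ∫ x, χ x * totalEnergyDensity (ρ₀ x) (u₀ x) (θ₀ x)|} ≤
                ENNReal.ofReal (C * Real.exp (-(C⁻¹ * ((N : ℝ) + 1))))) →
    ∃ ηp : ℝ, 0 < ηp ∧
    ∀ (a₀ θ₀ : T3 → ℝ) (u₀ : T3 → V3), Continuous a₀ → Continuous θ₀ → Continuous u₀ →
      (∀ x, 0 < a₀ x) → (∀ x, 0 < θ₀ x) →
      ∃ σ₀ : ℝ, 0 < σ₀ ∧ ∀ σ : ℝ, 0 < σ → σ < σ₀ →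
        ∀ (T : ℝ) (ρ θ : ℝ → T3 → ℝ) (u : ℝ → T3 → V3), IsHardSphereEulerSolution σ T ρ u θ →
          (∀ s ∈ Set.Ico 0 T, ∀ x, ρ s x * σ ^ 3 < ηp) →
          ∀ Φ : (N : ℕ) → HardSphereFlow (Torus.geometry (Fin 3)) (hsDiameter σ N) (N + 1),
            TendstoHydroFieldsAt (fun N => localGibbsLaw σ a₀ u₀ θ₀ N (Φ N)) Φ ρ u θ 0 →
            ∀ t ∈ Set.Ioo 0 T,
              ∃ K : ℝ, 0 ≤ K ∧ ∀ ε : ℝ, 0 < ε → ∃ N₀ : ℕ, ∀ N : ℕ, N₀ ≤ N → ∀ t' ∈ Set.Icc 0 t,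
                (klDiv ((Φ N).lawAt (localGibbsLaw σ a₀ u₀ θ₀ N (Φ N)) t')
                  (localGibbsLaw σ (fun x => ρ t' x * Rf (σ ^ 3 * ρ t' x)) (u t') (θ t') N (Φ N))).toReal ≤
                ((N : ℝ) + 1) * ε + K * ∫ r in (0 : ℝ)..t',
                  sSup ((fun s => (klDiv ((Φ N).lawAt (localGibbsLaw σ a₀ u₀ θ₀ N (Φ N)) s)
                    (localGibbsLaw σ (fun x => ρ s x * Rf (σ ^ 3 * ρ s x)) (u s) (θ s) N (Φ N))).toReal) ''
                    Set.Icc 0 r)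

/-- **v8 joint 1 = `WindowContinuityInBand`** — CRUDE SHORT-TIME CONTINUITY OF THE RELATIVE ENTROPY along the explicit
reference family, in band. For an insertion factor `Rf ∈ [1,2]`, Lipschitz on `[0,r]`, continuous positive profiles, there is
`σ₀` such that for `0 < σ < σ₀`, every classical solution, every tied flow family, `t ∈ (0,T)` with packing `ρ_s σ³ < r` on
`[0,t]`, every window scale `τ > 0` and `ε > 0`: for `N ≥ N₀` and all `s ≤ s′` in `[0,t]` with `s′ − s ≤ τ (N+1)^{-1/3}`,
`|H_N(s′) − H_N(s)| ≤ (N+1) ε`. Intended proof (worker brief): the landed one-window balance identity R1 with the smooth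
references `ψ_s`, `ψ_{s′}`; the streaming integral is `O((s′−s)(N+1))` in `L¹(f_s)` by conservation of `Σ|v_i|²`, bounded
third moments (ECT at one fixed level) and uniform bounds on the reference gradients; the transfer terms are bounded by the
window collisional activities (monotone in the window; CAT / CEAT at one fixed clamp level, contact ⇒ `|φ(x_i) − φ(x_j)| ≤
‖∇φ‖_∞ σ (N+1)^{-1/3}`), hence `O(τ (N+1)^{2/3})`; the reference switch `E_{f_{s′}}[Σ (g_{ψ_s} − g_{ψ_{s′}})] + log Z′/Z` is
`O((s′−s)(N+1))` by the time-Lipschitz bounds of `(log(ρ Rf(σ³ρ)), u, θ)` on `[0,t] × 𝕋³`. A registered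
stub SIGNATURE of the line (route-internal proposition in the vocabulary of the crux; Yau 1991 §2 for the method), not
a cited fact; LANDED for the line as `HydroLimitInBandContinuity.stub_windowContinuityInBand` (p118327). -/
def WindowContinuityInBand : Prop :=
  ∀ (r : ℝ) (Rf : ℝ → ℝ), 0 < r → (∀ x ∈ Icc 0 r, 1 ≤ Rf x ∧ Rf x ≤ 2) →
    (∃ L : NNReal, LipschitzOnWith L Rf (Icc 0 r)) →
    ∀ (a₀ θ₀ : T3 → ℝ) (u₀ : T3 → V3), Continuous a₀ → Continuous θ₀ → Continuous u₀ →
      (∀ x, 0 < a₀ x) → (∀ x, 0 < θ₀ x) →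
      ∃ σ₀ : ℝ, 0 < σ₀ ∧ ∀ σ : ℝ, 0 < σ → σ < σ₀ →
        ∀ (T : ℝ) (ρ θ : ℝ → T3 → ℝ) (u : ℝ → T3 → V3), IsHardSphereEulerSolution σ T ρ u θ →
          ∀ Φ : (N : ℕ) → HardSphereFlow (Torus.geometry (Fin 3)) (hsDiameter σ N) (N + 1),
            TendstoHydroFieldsAt (fun N => localGibbsLaw σ a₀ u₀ θ₀ N (Φ N)) Φ ρ u θ 0 →
            ∀ t ∈ Set.Ioo 0 T, (∀ s ∈ Set.Icc 0 t, ∀ x, ρ s x * σ ^ 3 < r) →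
              ∀ τ : ℝ, 0 < τ → ∀ ε : ℝ, 0 < ε → ∃ N₀ : ℕ, ∀ N : ℕ, N₀ ≤ N →
                ∀ s ∈ Set.Icc 0 t, ∀ s' ∈ Set.Icc 0 t, s ≤ s' → s' ≤ s + τ * ((N : ℝ) + 1) ^ (-(1 / 3 : ℝ)) →
                  |(klDiv ((Φ N).lawAt (localGibbsLaw σ a₀ u₀ θ₀ N (Φ N)) s')
                      (localGibbsLaw σ (fun x => ρ s' x * Rf (σ ^ 3 * ρ s' x)) (u s') (θ s') N (Φ N))).toReal -
                    (klDiv ((Φ N).lawAt (localGibbsLaw σ a₀ u₀ θ₀ N (Φ N)) s)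
                      (localGibbsLaw σ (fun x => ρ s x * Rf (σ ^ 3 * ρ s x)) (u s) (θ s) N (Φ N))).toReal| ≤
                  ((N : ℝ) + 1) * ε

/-- **v8 joint 2 = `OneWindowLedgerInBand` — THE HEART PROPER: the one-window entropy ledger on ONE COMMON WINDOW, in band,
END-supremum form.** Same frame as `LedgerIntegratedCoreInBand` (insertion factor with its power series / root equation /
`[1,2]`-bounds / Lipschitz bound / uniqueness; `η₀` carrying the matrix of `UniformLocalGibbsConcentration`), concluding: `∃ ηp`
such that for continuous positive profiles `∃ σ₀ ∀ σ < σ₀`, for every classical solution in the band, every tied flow family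
and `t ∈ (0,T)`: `∃ K ≥ 0 ∀ ε > 0 ∃ τ > 0 ∃ N₀ ∀ N ≥ N₀ ∀ s ≥ 0` with `s + w_N ≤ t` (`w_N := τ (N+1)^{-1/3}`):
`H_N(s + w_N) ≤ H_N(s) + K · w_N · sup_{[0, s + w_N]} H_N + w_N (N+1) ε`. This is what Yau's method gives per window when its
inputs hold with FAMILY-UNIFORM thresholds: the fluctuation channels priced by the entropy inequality at the window start at
ONE tilt `β` valid for all `s ∈ [0,t]` (`K ≍ channels/β`), the true-law remainders (clamp, cubic tails, coherent content,
profile drift inside the window) by CAT / CEAT / ECT / CSCV; the supremum up to the window END is allowed so that any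
intermediate-time entropy the bookkeeping produces is admissible (the glue `stub_ledgerFromWindows` converts it with
`WindowContinuityInBand`). A registered stub SIGNATURE of the line (route-internal proposition in the vocabulary of the
crux; Yau 1991 §2 and Olla–Varadhan–Yau 1993 §3 for the method), not a cited fact. -/
def OneWindowLedgerInBand : Prop :=
  ∀ (r : ℝ) (Rf : ℝ → ℝ), 0 < r →
    (∃ p : FormalMultilinearSeries ℝ ℝ ℝ, HasFPowerSeriesOnBall Rf p 0 (ENNReal.ofReal r)) →
    (∃ L : NNReal, LipschitzOnWith L Rf (Icc 0 r)) →
    (∀ x ∈ Ioo (-r) r, 0 < Rf x ∧ Rf x * (∑' j : ℕ, bE j / (j.factorial : ℝ) * (x * Rf x) ^ j) = 1) →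
    (∀ x ∈ Icc 0 r, 1 ≤ Rf x ∧ Rf x ≤ 2) → ContinuousOn Rf (Icc 0 r) →
    (∀ x ∈ Ioo (-r) r, ∀ R ∈ Icc (1 / 2 : ℝ) 2,
      R * (∑' j : ℕ, bE j / (j.factorial : ℝ) * (x * R) ^ j) = 1 → R = Rf x) →
    ∀ η₀ : ℝ, 0 < η₀ →
    (∀ (a θ₀ : T3 → ℝ) (u₀ : T3 → V3), Continuous a → Continuous θ₀ → Continuous u₀ → (∀ x, 0 < a x) →
      (∀ x, 0 < θ₀ x) → ∀ σ : ℝ, 0 < σ → σ ^ 3 * (⨆ x, a x) ≤ η₀ * ∫ x, a x →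
      ∃ ρ₀ : T3 → ℝ, Continuous ρ₀ ∧ (∀ x, 0 < ρ₀ x) ∧
        (∀ (N : ℕ) (Φ : HardSphereFlow (Torus.geometry (Fin 3)) (hsDiameter σ N) (N + 1)),
          IsProbabilityMeasure (localGibbsLaw σ a u₀ θ₀ N Φ)) ∧
        ∀ χ : T3 → ℝ, Continuous χ → ∀ δ : ℝ, 0 < δ → ∃ C : ℝ, 0 < C ∧
          ∀ (N : ℕ) (Φ : HardSphereFlow (Torus.geometry (Fin 3)) (hsDiameter σ N) (N + 1)),
            localGibbsLaw σ a u₀ θ₀ N Φ {z | δ < |empiricalDensityField z χ - ∫ x, χ x * ρ₀ x|} ≤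
                ENNReal.ofReal (C * Real.exp (-(C⁻¹ * ((N : ℝ) + 1)))) ∧
              localGibbsLaw σ a u₀ θ₀ N Φ
                  {z | δ < ‖empiricalMomentumField z χ - ∫ x, (χ x * ρ₀ x) • u₀ x‖} ≤
                ENNReal.ofReal (C * Real.exp (-(C⁻¹ * ((N : ℝ) + 1)))) ∧
              localGibbsLaw σ a u₀ θ₀ N Φ {z | δ < |empiricalEnergyField z χ -
                  ∫ x, χ x * totalEnergyDensity (ρ₀ x) (u₀ x) (θ₀ x)|} ≤
                ENNReal.ofReal (C * Real.exp (-(C⁻¹ * ((N : ℝ) + 1))))) →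
    ∃ ηp : ℝ, 0 < ηp ∧
    ∀ (a₀ θ₀ : T3 → ℝ) (u₀ : T3 → V3), Continuous a₀ → Continuous θ₀ → Continuous u₀ →
      (∀ x, 0 < a₀ x) → (∀ x, 0 < θ₀ x) →
      ∃ σ₀ : ℝ, 0 < σ₀ ∧ ∀ σ : ℝ, 0 < σ → σ < σ₀ →
        ∀ (T : ℝ) (ρ θ : ℝ → T3 → ℝ) (u : ℝ → T3 → V3), IsHardSphereEulerSolution σ T ρ u θ →
          (∀ s ∈ Set.Ico 0 T, ∀ x, ρ s x * σ ^ 3 < ηp) →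
          ∀ Φ : (N : ℕ) → HardSphereFlow (Torus.geometry (Fin 3)) (hsDiameter σ N) (N + 1),
            TendstoHydroFieldsAt (fun N => localGibbsLaw σ a₀ u₀ θ₀ N (Φ N)) Φ ρ u θ 0 →
            ∀ t ∈ Set.Ioo 0 T,
              ∃ K : ℝ, 0 ≤ K ∧ ∀ ε : ℝ, 0 < ε → ∃ τ : ℝ, 0 < τ ∧ ∃ N₀ : ℕ, ∀ N : ℕ, N₀ ≤ N →
                ∀ s : ℝ, 0 ≤ s → s + τ * ((N : ℝ) + 1) ^ (-(1 / 3 : ℝ)) ≤ t →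
                (klDiv ((Φ N).lawAt (localGibbsLaw σ a₀ u₀ θ₀ N (Φ N)) (s + τ * ((N : ℝ) + 1) ^ (-(1 / 3 : ℝ))))
                  (localGibbsLaw σ (fun x => ρ (s + τ * ((N : ℝ) + 1) ^ (-(1 / 3 : ℝ))) x *
                      Rf (σ ^ 3 * ρ (s + τ * ((N : ℝ) + 1) ^ (-(1 / 3 : ℝ))) x))
                    (u (s + τ * ((N : ℝ) + 1) ^ (-(1 / 3 : ℝ)))) (θ (s + τ * ((N : ℝ) + 1) ^ (-(1 / 3 : ℝ))))
                    N (Φ N))).toReal ≤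
                (klDiv ((Φ N).lawAt (localGibbsLaw σ a₀ u₀ θ₀ N (Φ N)) s)
                  (localGibbsLaw σ (fun x => ρ s x * Rf (σ ^ 3 * ρ s x)) (u s) (θ s) N (Φ N))).toReal +
                K * (τ * ((N : ℝ) + 1) ^ (-(1 / 3 : ℝ))) *
                  sSup ((fun s' => (klDiv ((Φ N).lawAt (localGibbsLaw σ a₀ u₀ θ₀ N (Φ N)) s')
                    (localGibbsLaw σ (fun x => ρ s' x * Rf (σ ^ 3 * ρ s' x)) (u s') (θ s') N (Φ N))).toReal) ''
                    Set.Icc 0 (s + τ * ((N : ℝ) + 1) ^ (-(1 / 3 : ℝ)))) +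
                (τ * ((N : ℝ) + 1) ^ (-(1 / 3 : ℝ))) * ((N : ℝ) + 1) * ε

/-! ### The real-analysis core: summing one-window bounds on a grid -/

/-- **Multi-window summation (real analysis).** Let `H ≥ 0` be bounded above on `[0,t]` with `H 0 = 0`, and let
`S r := sup (H '' [0,r])` be its running supremum. Suppose the ONE-WINDOW bound
`H (s + w) ≤ H s + K w S(s + w) + w M ε₁` for `0 ≤ s`, `s + w ≤ t` (window `w > 0`, END-supremum form) and the
window CONTINUITY bound `|H s′ − H s| ≤ M ε₂` for `s ≤ s′ ≤ s + w` in `[0,t]`. Then for every `t′ ∈ [0,t]`,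
`H t′ ≤ C + K ∫₀^{t′} S` as soon as `M ε₂ + t M ε₁ + K t M ε₂ ≤ C`. Proof: on the grid `s_k = k w` below `t′`
(`n = ⌊t′/w⌋`) the window bounds telescope to `H(s_n) ≤ K w Σ_{j<n} S(s_{j+1}) + n w M ε₁`; continuity gives
`S(s_{j+1}) ≤ S(s_j) + M ε₂` (END → START) and `H t′ ≤ H(s_n) + M ε₂` (last partial window); the left Riemann sum
`w Σ_{j<n} S(s_j)` of the monotone nonnegative `S` is at most `∫₀^{s_n} S ≤ ∫₀^{t′} S`; collect with `n w ≤ t′ ≤ t`.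
[folklore] -/
theorem ledger_sum_of_windows {H : ℝ → ℝ} {t w K B M ε₁ ε₂ C : ℝ} (hw : 0 < w) (hK : 0 ≤ K)
    (hMε₁ : 0 ≤ M * ε₁) (hMε₂ : 0 ≤ M * ε₂)
    (hHB : ∀ s ∈ Icc 0 t, H s ≤ B) (hzero : H 0 = 0)
    (hstep : ∀ s : ℝ, 0 ≤ s → s + w ≤ t →
      H (s + w) ≤ H s + K * w * sSup (H '' Icc 0 (s + w)) + w * M * ε₁)
    (hcont : ∀ s ∈ Icc 0 t, ∀ s' ∈ Icc 0 t, s ≤ s' → s' ≤ s + w → |H s' - H s| ≤ M * ε₂)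
    (hC : M * ε₂ + t * (M * ε₁) + K * t * (M * ε₂) ≤ C) :
    ∀ t' ∈ Icc 0 t, H t' ≤ C + K * ∫ r in (0 : ℝ)..t', sSup (H '' Icc 0 r) := by
  -- the running supremum
  set S : ℝ → ℝ := fun r => sSup (H '' Icc 0 r) with hS
  have hbdd : ∀ r ∈ Icc 0 t, BddAbove (H '' Icc 0 r) := fun r hr =>
    ⟨B, by rintro y ⟨s, hs, rfl⟩; exact hHB s ⟨hs.1, hs.2.trans hr.2⟩⟩
  have hne : ∀ r : ℝ, 0 ≤ r → (H '' Icc 0 r).Nonempty := fun r hr => ⟨H 0, 0, ⟨le_rfl, hr⟩, rfl⟩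
  have hHS : ∀ r ∈ Icc 0 t, ∀ s ∈ Icc 0 r, H s ≤ S r := fun r hr s hs =>
    le_csSup (hbdd r hr) ⟨s, hs, rfl⟩
  have hSnn : ∀ r ∈ Icc 0 t, 0 ≤ S r := fun r hr => hzero.symm.le.trans (hHS r hr 0 ⟨le_rfl, hr.1⟩)
  have hmono : MonotoneOn S (Icc 0 t) := fun r₁ hr₁ r₂ hr₂ h12 =>
    csSup_le_csSup (hbdd r₂ hr₂) (hne r₁ hr₁.1) (image_mono (Icc_subset_Icc le_rfl h12))
  -- END → START: the supremum up to the window end exceeds the one up to its start by at most `M ε₂`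
  have hSstep : ∀ s : ℝ, 0 ≤ s → s + w ≤ t → S (s + w) ≤ S s + M * ε₂ := by
    intro s hs hsw
    have hst : s ∈ Icc 0 t := ⟨hs, by linarith⟩
    refine csSup_le (hne _ (by linarith)) ?_
    rintro y ⟨r, hr, rfl⟩
    rcases le_or_gt r s with hrs | hrs
    · exact (hHS s hst r ⟨hr.1, hrs⟩).trans (le_add_of_nonneg_right hMε₂)
    · have h1 := hcont s hst r ⟨hr.1, hr.2.trans hsw⟩ hrs.le hr.2
      have h2 := hHS s hst s ⟨hs, le_rfl⟩
      linarith [(abs_le.mp h1).2]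
  intro t' ht'
  -- the grid `s_k = k w`, `k ≤ n = ⌊t′/w⌋`
  set n : ℕ := ⌊t' / w⌋₊ with hn
  have hnw : (n : ℝ) * w ≤ t' := by rw [← le_div_iff₀ hw, hn]; exact Nat.floor_le (div_nonneg ht'.1 hw.le)
  have ht'n : t' ≤ (n : ℝ) * w + w := by
    have h := Nat.lt_floor_add_one (t' / w)
    rw [← hn, div_lt_iff₀ hw] at h
    linarith
  have hnwt : (n : ℝ) * w ≤ t := hnw.trans ht'.2
  have hgrid : ∀ k : ℕ, k ≤ n → (k : ℝ) * w ∈ Icc 0 t := fun k hk =>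
    ⟨mul_nonneg k.cast_nonneg hw.le, (mul_le_mul_of_nonneg_right (Nat.cast_le.mpr hk) hw.le).trans hnwt⟩
  have hgrid' : ∀ k : ℕ, k < n → (k : ℝ) * w + w ≤ t := fun k hk => by
    have h : ((k : ℝ) + 1) * w ≤ (n : ℝ) * w :=
      mul_le_mul_of_nonneg_right (by exact_mod_cast Nat.succ_le_of_lt hk) hw.le
    linarith
  -- STEP 2: telescoping of the one-window bounds along the grid
  have htel : ∀ k : ℕ, k ≤ n → H ((k : ℝ) * w) ≤
      K * w * ∑ j ∈ Finset.range k, S ((j : ℝ) * w + w) + (k : ℝ) * w * (M * ε₁) := by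
    intro k
    induction k with
    | zero => intro; simp [hzero]
    | succ k ih =>
      intro hk
      have hk' : k < n := Nat.lt_of_succ_le hk
      have h1 := hstep ((k : ℝ) * w) (mul_nonneg k.cast_nonneg hw.le) (hgrid' k hk')
      have h2 := ih hk'.le
      rw [Nat.cast_succ, add_mul, one_mul, Finset.sum_range_succ]
      have h3 : K * w * sSup (H '' Icc 0 ((k : ℝ) * w + w)) = K * w * S ((k : ℝ) * w + w) := rfl
      linarith
  -- STEP 3: END → START along the grid
  have hsum3 : ∑ j ∈ Finset.range n, S ((j : ℝ) * w + w) ≤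
      ∑ j ∈ Finset.range n, S ((j : ℝ) * w) + (n : ℝ) * (M * ε₂) := by
    have h : ∀ j ∈ Finset.range n, S ((j : ℝ) * w + w) ≤ S ((j : ℝ) * w) + M * ε₂ := fun j hj =>
      hSstep _ (mul_nonneg j.cast_nonneg hw.le) (hgrid' j (Finset.mem_range.mp hj))
    calc ∑ j ∈ Finset.range n, S ((j : ℝ) * w + w)
        ≤ ∑ j ∈ Finset.range n, (S ((j : ℝ) * w) + M * ε₂) := Finset.sum_le_sum h
      _ = ∑ j ∈ Finset.range n, S ((j : ℝ) * w) + (n : ℝ) * (M * ε₂) := by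
        rw [Finset.sum_add_distrib, Finset.sum_const, Finset.card_range, nsmul_eq_mul]
  -- STEP 4: the left Riemann sum of the monotone nonnegative `S` is below its integral
  have hRiem : w * ∑ j ∈ Finset.range n, S ((j : ℝ) * w) ≤ ∫ r in (0 : ℝ)..t', S r := by
    have hk1 : ∀ k : ℕ, (((k + 1 : ℕ) : ℝ)) * w = (k : ℝ) * w + w := fun k => by push_cast; ring
    have hsub : ∀ k : ℕ, k < n → Icc ((k : ℝ) * w) (((k + 1 : ℕ) : ℝ) * w) ⊆ Icc 0 t := fun k hk =>
      Icc_subset_Icc (hgrid k hk.le).1 (hgrid (k + 1) (Nat.succ_le_of_lt hk)).2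
    have hle : ∀ k : ℕ, (k : ℝ) * w ≤ ((k + 1 : ℕ) : ℝ) * w := fun k => by rw [hk1]; linarith
    have hint : ∀ k : ℕ, k < n →
        IntervalIntegrable S volume ((fun k : ℕ => (k : ℝ) * w) k) ((fun k : ℕ => (k : ℝ) * w) (k + 1)) :=
      fun k hk => ((hmono.mono (hsub k hk)).mono (by rw [uIcc_of_le (hle k)])).intervalIntegrable
    have hcell : ∀ k ∈ Finset.range n,
        w * S ((k : ℝ) * w) ≤ ∫ r in ((k : ℝ) * w)..(((k + 1 : ℕ) : ℝ) * w), S r := fun k hk => by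
      have hk := Finset.mem_range.mp hk
      have hconst : ∫ _ in ((k : ℝ) * w)..(((k + 1 : ℕ) : ℝ) * w), S ((k : ℝ) * w) = w * S ((k : ℝ) * w) := by
        rw [intervalIntegral.integral_const, smul_eq_mul, hk1]; ring
      rw [← hconst]
      exact intervalIntegral.integral_mono_on (hle k) intervalIntegrable_const (hint k hk)
        fun x hx => hmono (hgrid k hk.le) (hsub k hk hx) hx.1
    have hsum : ∑ k ∈ Finset.range n, ∫ r in ((k : ℝ) * w)..(((k + 1 : ℕ) : ℝ) * w), S r =
        ∫ r in (((0 : ℕ) : ℝ) * w)..((n : ℝ) * w), S r :=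
      intervalIntegral.sum_integral_adjacent_intervals hint
    rw [Nat.cast_zero, zero_mul] at hsum
    have hnn : (0 : ℝ → ℝ) ≤ᵐ[volume.restrict (Ioc (0 : ℝ) t')] S :=
      ae_restrict_of_forall_mem (measurableSet_Ioc : MeasurableSet (Ioc (0 : ℝ) t')) fun x hx =>
        hSnn x ⟨hx.1.le, hx.2.trans ht'.2⟩
    have hint' : IntervalIntegrable S volume 0 t' :=
      (hmono.mono (by rw [uIcc_of_le ht'.1]; exact Icc_subset_Icc le_rfl ht'.2)).intervalIntegrable
    calc w * ∑ j ∈ Finset.range n, S ((j : ℝ) * w)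
        = ∑ j ∈ Finset.range n, w * S ((j : ℝ) * w) := Finset.mul_sum _ _ _
      _ ≤ ∑ k ∈ Finset.range n, ∫ r in ((k : ℝ) * w)..(((k + 1 : ℕ) : ℝ) * w), S r := Finset.sum_le_sum hcell
      _ = ∫ r in (0 : ℝ)..((n : ℝ) * w), S r := hsum
      _ ≤ ∫ r in (0 : ℝ)..t', S r :=
        intervalIntegral.integral_mono_interval le_rfl (mul_nonneg n.cast_nonneg hw.le) hnw hnn hint'
  -- STEP 1 (the last, partial window) and collection
  have hlast : H t' ≤ H ((n : ℝ) * w) + M * ε₂ := by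
    have h1 := hcont ((n : ℝ) * w) (hgrid n le_rfl) t' ht' hnw ht'n
    linarith [(abs_le.mp h1).2]
  have h2 := htel n le_rfl
  have hKw : 0 ≤ K * w := mul_nonneg hK hw.le
  have h3 := mul_le_mul_of_nonneg_left hsum3 hKw
  have h4 := mul_le_mul_of_nonneg_left hRiem hK
  have h5 : K * ((n : ℝ) * w) * (M * ε₂) ≤ K * t * (M * ε₂) :=
    mul_le_mul_of_nonneg_right (mul_le_mul_of_nonneg_left hnwt hK) hMε₂
  have h6 : (n : ℝ) * w * (M * ε₁) ≤ t * (M * ε₁) := mul_le_mul_of_nonneg_right hnwt hMε₁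
  calc H t' ≤ H ((n : ℝ) * w) + M * ε₂ := hlast
    _ ≤ K * w * ∑ j ∈ Finset.range n, S ((j : ℝ) * w + w) + (n : ℝ) * w * (M * ε₁) + M * ε₂ := by linarith
    _ ≤ K * w * (∑ j ∈ Finset.range n, S ((j : ℝ) * w) + (n : ℝ) * (M * ε₂)) +
          (n : ℝ) * w * (M * ε₁) + M * ε₂ := by linarith
    _ = K * (w * ∑ j ∈ Finset.range n, S ((j : ℝ) * w)) + K * ((n : ℝ) * w) * (M * ε₂) +
          (n : ℝ) * w * (M * ε₁) + M * ε₂ := by ring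
    _ ≤ K * (∫ r in (0 : ℝ)..t', S r) + K * t * (M * ε₂) + t * (M * ε₁) + M * ε₂ := by linarith
    _ ≤ C + K * ∫ r in (0 : ℝ)..t', S r := by linarith

/-- **Stub `stub_ledgerFromWindows` of line `IdeatorOneSketch` (crux stmt-9133, skeleton v8): the multi-window
summation.** The one-window ledger (END-supremum form), the window continuity and the a-priori bound imply the integrated
ledger `LedgerIntegratedCoreInBand`: `ηp := min ηp_W r`, `σ₀ := min σ_W (min σ_C (min σ_z (1/2)))`; `H_N(0) = 0`
(`QuenchedCellClock.stub_timeZeroReference` + `klDiv_lawAt_zero_localGibbsLaw`); `ε₁ := ε/(2(t+1))`,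
`ε₂ := ε/(2(Kt+1))`, `N₀ := max N₁ N₂`; at fixed `N ≥ N₀` the real-analysis summation `ledger_sum_of_windows` on the
grid `s_k = k τ (N+1)^{-1/3}` below `t′`. [cite: Yau1991, §2] -/
theorem stub_ledgerFromWindows :
    OneWindowLedgerInBand → WindowContinuityInBand → LedgerAprioriBound → LedgerIntegratedCoreInBand := by
  intro hW hC hA r Rf hr hana hLip hsol hbd hcont huniq η₀ hη₀ HU
  obtain ⟨ηW, hηW, HW⟩ := hW r Rf hr hana hLip hsol hbd hcont huniq η₀ hη₀ HU
  refine ⟨min ηW r, lt_min hηW hr, fun a₀ θ₀ u₀ ha hθ hu ha0 hθ0 => ?_⟩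
  obtain ⟨σW, hσW, HσW⟩ := HW a₀ θ₀ u₀ ha hθ hu ha0 hθ0
  obtain ⟨σC, hσC, HσC⟩ := hC r Rf hr hbd hLip a₀ θ₀ u₀ ha hθ hu ha0 hθ0
  obtain ⟨σz, hσz, Hz⟩ :=
    Theorems.QuenchedCellClock.stub_timeZeroReference hr hsol hbd hcont huniq a₀ θ₀ u₀ ha hθ hu ha0 hθ0
  refine ⟨min σW (min σC (min σz (1 / 2))), lt_min hσW (lt_min hσC (lt_min hσz (by norm_num))), ?_⟩
  intro σ hσ hσlt T ρ θ u hE hguard Φ htie t ht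
  have hσW' : σ < σW := hσlt.trans_le (min_le_left _ _)
  have hσC' : σ < σC := hσlt.trans_le ((min_le_right _ _).trans (min_le_left _ _))
  have hσz' : σ < σz := hσlt.trans_le ((min_le_right _ _).trans ((min_le_right _ _).trans (min_le_left _ _)))
  have hσ2' : σ < 1 / 2 := hσlt.trans_le ((min_le_right _ _).trans ((min_le_right _ _).trans (min_le_right _ _)))
  have hT : 0 < T := ht.1.trans ht.2
  -- packing from THE GUARD: `< ηW` on `[0,T)` and `< r` on `[0,t]`
  have hpackW : ∀ s ∈ Set.Ico 0 T, ∀ x, ρ s x * σ ^ 3 < ηW := fun s hs x =>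
    (hguard s hs x).trans_le (min_le_left _ _)
  have hpackr : ∀ s ∈ Set.Icc 0 t, ∀ x, ρ s x * σ ^ 3 < r := fun s hs x =>
    (hguard s ⟨hs.1, hs.2.trans_lt ht.2⟩ x).trans_le (min_le_right _ _)
  -- the three hypotheses along the explicit reference family, and time zero
  obtain ⟨K, hK, HK⟩ := HσW σ hσ hσW' T ρ θ u hE hpackW Φ htie t ht
  have HCt := HσC σ hσ hσC' T ρ θ u hE Φ htie t ht hpackr
  have hB : ∀ N : ℕ, ∃ B : ℝ, ∀ s ∈ Set.Icc 0 t,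
      klDiv ((Φ N).lawAt (localGibbsLaw σ a₀ u₀ θ₀ N (Φ N)) s)
        (localGibbsLaw σ (fun x => ρ s x * Rf (σ ^ 3 * ρ s x)) (u s) (θ s) N (Φ N)) ≤ ENNReal.ofReal B :=
    fun N => hA r Rf hr hbd hcont a₀ θ₀ u₀ ha hθ hu ha0 hθ0 σ hσ hσ2' T ρ θ u hE t ht hpackr N (Φ N)
  have hlaw0 := Hz σ hσ hσz' T ρ θ u hE hT Φ htie
  refine ⟨K, hK, fun ε hε => ?_⟩
  -- the two auxiliary accuracies
  have ht0 : 0 < t := ht.1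
  have hKt : 0 ≤ K * t := mul_nonneg hK ht0.le
  set ε₁ : ℝ := ε / (2 * (t + 1)) with hε₁
  set ε₂ : ℝ := ε / (2 * (K * t + 1)) with hε₂
  have hε₁pos : 0 < ε₁ := by positivity
  have hε₂pos : 0 < ε₂ := by positivity
  have hεsum : ε₂ + t * ε₁ + K * t * ε₂ ≤ ε := by
    have h1 : ε₂ + K * t * ε₂ = ε / 2 := by rw [hε₂]; field_simp; ring
    have h2 : t * ε₁ ≤ ε / 2 := by
      rw [hε₁, ← mul_div_assoc, div_le_div_iff₀ (by positivity) (by norm_num)]; nlinarith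
    linarith
  obtain ⟨τ, hτ, N₁, HN₁⟩ := HK ε₁ hε₁pos
  obtain ⟨N₂, HN₂⟩ := HCt τ hτ ε₂ hε₂pos
  refine ⟨max N₁ N₂, fun N hN t' ht' => ?_⟩
  have hM : (0 : ℝ) < (N : ℝ) + 1 := by positivity
  have hwpos : 0 < τ * ((N : ℝ) + 1) ^ (-(1 / 3 : ℝ)) := mul_pos hτ (Real.rpow_pos_of_pos hM _)
  -- the entropy as a real function of time, at this `N`
  set H : ℝ → ℝ := fun s =>
    (klDiv ((Φ N).lawAt (localGibbsLaw σ a₀ u₀ θ₀ N (Φ N)) s)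
      (localGibbsLaw σ (fun x => ρ s x * Rf (σ ^ 3 * ρ s x)) (u s) (θ s) N (Φ N))).toReal with hH
  obtain ⟨B, hBN⟩ := hB N
  have hHB : ∀ s ∈ Set.Icc 0 t, H s ≤ max B 0 := fun s hs =>
    ENNReal.toReal_le_of_le_ofReal (le_max_right _ _)
      ((hBN s hs).trans (ENNReal.ofReal_le_ofReal (le_max_left _ _)))
  have hH0 : H 0 = 0 := by
    simp only [hH, hlaw0 N, Theorems.EntropyClockDock.klDiv_lawAt_zero_localGibbsLaw hσ2'.le ha hθ hu ha0 hθ0 N (Φ N),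
      ENNReal.toReal_zero]
  have hCst : ((N : ℝ) + 1) * ε₂ + t * (((N : ℝ) + 1) * ε₁) + K * t * (((N : ℝ) + 1) * ε₂) ≤
      ((N : ℝ) + 1) * ε := by
    have h := mul_le_mul_of_nonneg_left hεsum hM.le
    nlinarith
  exact ledger_sum_of_windows (H := H) (B := max B 0) hwpos hK (by positivity) (by positivity) hHB hH0
    (fun s hs hsw => HN₁ N ((le_max_left _ _).trans hN) s hs hsw)
    (fun s hs s' hs' h1 h2 => HN₂ N ((le_max_right _ _).trans hN) s hs s' hs' h1 h2) hCst t' ht'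

end Summit.AtomisticToContinuum.HydrodynamicLimit.Theorems.HydroLimitInBandLedger

end
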